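import Literature.AlgebraicGeometry.Frobenioids.Thm42PreservesPrimarySchemaClosure
import Literature.AlgebraicGeometry.Frobenioids.Thm42PreservesDivFrobTrivialCounterexample
import Literature.AlgebraicGeometry.Frobenioids.Thm49Arithmetic
import Literature.AlgebraicGeometry.Frobenioids.Thm34HypothesesInstances
import HarnessLib

/-!
# Frobenioids I, Theorem 4.2 (i), sub-DAG predicate `FrdI.T42.PreservesPrimaryAt F₁ F₂ Ψ A`: 0-hypothesis
# INSTANCE FORMS — at THE perfections of the arithmetic Frobenioids `C_{K₁/F₁} ⥲ C_{K₂/F₂}` for EVERY `Ψ`,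
# at a kernel `Setting` of record, and for `Ψ = 𝟭` on any structure functor

S. Mochizuki, *The geometry of Frobenioids I: the general theory*, Kyushu J. Math. **62** (2008) 293–400
[MochizukiFrdI2008], §4, Theorem 4.2 (i), proof, kurims p. 78 ll. 47–53
[cite: MochizukiFrdI2008, Thm. 4.2 (i) p.78]: for an equivalence `Ψ : C₁ ⥲ C₂` of Frobenioids of standard,
isotropic type, "`Ψ` maps primary steps to or from `A₁` to primary steps to or from `A₂`" (with the primary
composites `B₁ → A₁ → C₁`).

PROOF-ONLY companion (abc-iut cell, block F, KEY row INST59K2, seat abc-iut-f-002; 0 `def` / `structure`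
/ `instance` / notation, no `Prop` fact) of `Thm42Sub.lean` (seat abc-iut-L1-t14), FACT-LIST row **F-2396**
`FrdI.T42.PreservesPrimaryAt (F₁ : C₁ ⥤ ElemFrobenioid Φ₁) (F₂ : C₂ ⥤ ElemFrobenioid Φ₂) (Ψ : C₁ ≌ C₂) (A : C₁)`.
State of the row in the tree: a SCHEMA (body-head of sub-DAG rows L04–L07); universal closure REFUTED
(`FrdI.T42.not_forall_preservesPrimaryAt`, abc-iut-f-012, witness `not_preservesPrimaryAt_standard`: `Ψ = 𝟭`
on the standard Frobenioid but a DIFFERENT, zero-section, second structure functor); content = the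
CONDITIONAL closer `FrdI.T42.preservesPrimaryAt (S : Setting F₁ F₂ Ψ) (A : C₁)` (abc-iut-L1,
`Thm42PrimaryStepsPropagation.lean`).  The L-F kernel census (plan/LF-KERNEL-STATUS.tsv 2026-08-27, col 14)
found NO theorem whose conclusion HEAD is `PreservesPrimaryAt …` without a hypothesis.

THIS FILE supplies those instance forms:
* `preservesPrimaryAt_arith_perfection` — **print's sentence at GENUINE data in print generality**: for
  number fields `F_i ⊆ K_i` (`K_i/F_i` Galois) and EVERY equivalence of categories
  `Ψ : C_{K₁/F₁} ⥲ C_{K₂/F₂}` between THE arithmetic Frobenioids of Example 6.3 (standard, isotropic,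
  non-group-like type by Thm. 6.4 (i); bases `B(Gal(K_i/F_i))⁰` of FSM-type; `Φ_i` perf-factorial — all
  theorems of the tree), the induced `Ψ^pf : C_{K₁/F₁}^pf ⥲ C_{K₂/F₂}^pf` ("passing to the perfections",
  p. 78 l. 36) maps primary steps to or from `A` to primary steps, with primary composites, at EVERY object
  `A` of the perfection.  Route: Thm. 3.4 (iii) makes `Ψ` Frobenius-compatible (abc-iut's
  `PreFrobenioid.isFrobeniusCompatible_arith`, `Thm34HypothesesInstances.lean`), the setting of the proof
  holds at the perfections
  (`setting_arith_perfection`, by abc-iut-L1's `FrdI.T42.setting_perfection` exactly as in abc-iut-w4-d105's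
  `Thm49CompatOfFunctor`), then `FrdI.T42.preservesPrimaryAt` BY NAME; `…_refl` is the self-equivalence case;
* `preservesPrimaryAt_dilatingWitness`, `preservesPrimaryAt_dilatingWitness_A₀` — at THE kernel `Setting`
  of record: the tree holds exactly one closed term of type `FrdI.T42.Setting _ _ _`, abc-iut-f-050's
  `FrdI.T42.DilatingWitness.setting : Setting F F Ψe` (the model Frobenioid `C = ModelFrobenioid Φ 0_D 0`
  of Thm. 5.2 over `D = B(ℝ,+)` with `Φ ≡ ℝ_{≥0}` — a Frobenioid of perfect, isotropic type with `Φ`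
  perf-factorial — and its non-trivial "twist" self-equivalence `Ψe`, every Thm. 3.4 field verified).
  HONEST LABEL: that carrier is a KERNEL TEST MODEL of the cell ("OURS, not a construction of the paper",
  built to refute row T42-L02 as typed: its `Φ` is dilating), but it is GENUINE data for THIS row — a
  bona fide `Setting`, the hypothesis structure under which print's sentence is proved — so the closer
  applies BY NAME; at every object `A` (inhabited binder: `A₀ = (∗,[0])`), and binder-free at `A₀`;
* `preservesPrimaryAt_refl` — for EVERY structure functor `F` and object `A`, the predicate holds for
  the identity equivalence with the SAME structure on both sides (`Ψ = 𝟭`, `F₂ = F₁`): definitionally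
  `𝟭` maps a primary step to itself.  LABELLED TRIVIAL — it isolates what the closure refuter exploits:
  `not_preservesPrimaryAt_standard` also has `Ψ = 𝟭` but a different second structure functor `F₂`;
* `preservesPrimaryAt_standard_refl` — the CLOSED specialisation at the standard Frobenioid `F_{ℤ≥0}`
  (Def. 1.1 (iii)) and its object `A`, side by side with the refuter (`preservesPrimaryAt_census_standard_refl`).
Nothing of `Thm42Sub.lean` is restated or edited.  [FrdI] is refereed, undisputed mathematics; an
instance-form theorem about OUR typed statement is not a theorem about IUT in print; no side taken on
[IUTchIII] Cor. 3.12.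
-/

namespace Literature.AlgebraicGeometry.Frobenioids

open CategoryTheory Opposite

namespace FrdI.T42

universe w v v' u u'

/-! ### `Ψ = 𝟭`, same structure on both sides: the predicate holds for every `F` and `A` (trivial) -/

/-- **F-2396, INSTANCE FORM for `Ψ = 𝟭` (LABELLED TRIVIAL).** For every structure functor
`F : C → F_Φ` and every object `A`, the identity equivalence of `C` — with the SAME structure `F` on both
sides — "maps primary steps to or from `A` to primary steps to or from `A`": `𝟭` maps each arrow to
itself.  (The closure refuter `not_preservesPrimaryAt_standard` keeps `Ψ = 𝟭` but changes the second
structure functor.) [cite: MochizukiFrdI2008, Thm. 4.2 (i) p.78] -/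
theorem preservesPrimaryAt_refl {D : Type u} [Category.{v} D] {Φ : Dᵒᵖ ⥤ CommMonCat.{w}}
    {C : Type u'} [Category.{v'} C] (F : C ⥤ ElemFrobenioid Φ) (A : C) :
    Literature.AlgebraicGeometry.Frobenioids.FrdI.T42.PreservesPrimaryAt F F
      (CategoryTheory.Equivalence.refl : C ≌ C) A := by
  refine ⟨fun B φ _ h => ?_, fun B ψ _ h => ?_, fun B B' φ ψ _ _ _ h _ => ?_⟩
  · exact h
  · exact h
  · exact h

/-! ### At THE kernel `Setting` of record (abc-iut-f-050's model with its twist self-equivalence) -/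

/-- **F-2396, INSTANCE (genuine `Setting`; carrier = the cell's kernel test model, LABELLED).** For the
model Frobenioid `C = ModelFrobenioid Φ 0_D 0` over `D = B(ℝ,+)`, `Φ ≡ ℝ_{≥0}` (perfect, isotropic,
perf-factorial) and its twist self-equivalence `Ψe` — for which EVERY hypothesis of the proof of Thm. 4.2
recorded in `FrdI.T42.Setting` holds (`DilatingWitness.setting`) — `Ψe` maps primary steps to or from `A`
to primary steps, with primary composites, at EVERY object `A` (`preservesPrimaryAt` ∘ `setting`).
[cite: MochizukiFrdI2008, Thm. 4.2 (i) p.78] -/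
theorem preservesPrimaryAt_dilatingWitness (A : DilatingWitness.C) :
    Literature.AlgebraicGeometry.Frobenioids.FrdI.T42.PreservesPrimaryAt
      DilatingWitness.F DilatingWitness.F DilatingWitness.Ψe A :=
  preservesPrimaryAt DilatingWitness.setting A

/-- **F-2396, INSTANCE (CLOSED, binder-free)** at the object `A₀ = (∗, [0])` of the kernel `Setting` of
record. [cite: MochizukiFrdI2008, Thm. 4.2 (i) p.78] -/
theorem preservesPrimaryAt_dilatingWitness_A₀ :
    Literature.AlgebraicGeometry.Frobenioids.FrdI.T42.PreservesPrimaryAt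
      DilatingWitness.F DilatingWitness.F DilatingWitness.Ψe DilatingWitness.A₀ :=
  preservesPrimaryAt_dilatingWitness DilatingWitness.A₀

/-! ### At the standard Frobenioid `F_{ℤ≥0}` (Definition 1.1 (iii)) with `Ψ = 𝟭` — closed, next to the refuter -/

/-- **F-2396, INSTANCE (CLOSED) at the standard Frobenioid with `Ψ = 𝟭` and the SAME structure on both
sides**: primary steps to or from the object `A` of `F_{ℤ≥0}` are preserved — contrast
`not_preservesPrimaryAt_standard` (same `Ψ`, same `A`, zero-section second structure).
[cite: MochizukiFrdI2008, Thm. 4.2 (i) p.78] -/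
theorem preservesPrimaryAt_standard_refl :
    Literature.AlgebraicGeometry.Frobenioids.FrdI.T42.PreservesPrimaryAt
      (ElemFrobenioid.toChar StandardFrobenioidExample.Φst) (ElemFrobenioid.toChar StandardFrobenioidExample.Φst)
      (CategoryTheory.Equivalence.refl :
        ElemFrobenioid StandardFrobenioidExample.Φst ≌ ElemFrobenioid StandardFrobenioidExample.Φst)
      StandardFrobenioidExample.A :=
  preservesPrimaryAt_refl _ _

/-- **Census of F-2396 at the standard Frobenioid, `Ψ = 𝟭`, object `A`**: with the zero-section second
structure the predicate FAILS (`not_preservesPrimaryAt_standard`, hence the closure is false), with the same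
structure on both sides it HOLDS — the schema's free second structure functor is exactly what the refuter
exploits. [cite: MochizukiFrdI2008, Thm. 4.2 (i) p.78] -/
theorem preservesPrimaryAt_census_standard_refl :
    (¬ PreservesPrimaryAt (ElemFrobenioid.toChar StandardFrobenioidExample.Φst)
        (ElemFrobenioid.baseFunctor StandardFrobenioidExample.Φst ⋙
          ElemFrobenioid.zeroSection (charFunctor StandardFrobenioidExample.Φst))
        (CategoryTheory.Equivalence.refl :
          ElemFrobenioid StandardFrobenioidExample.Φst ≌ ElemFrobenioid StandardFrobenioidExample.Φst)
        StandardFrobenioidExample.A) ∧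
      PreservesPrimaryAt (ElemFrobenioid.toChar StandardFrobenioidExample.Φst)
        (ElemFrobenioid.toChar StandardFrobenioidExample.Φst)
        (CategoryTheory.Equivalence.refl :
          ElemFrobenioid StandardFrobenioidExample.Φst ≌ ElemFrobenioid StandardFrobenioidExample.Φst)
        StandardFrobenioidExample.A :=
  ⟨not_preservesPrimaryAt_standard, preservesPrimaryAt_standard_refl⟩

/-! ### At THE perfections of the arithmetic Frobenioids `C_{K₁/F₁} ⥲ C_{K₂/F₂}`, for EVERY `Ψ` -/

section ArithPerfection

open PreFrobenioidData PreFrobenioid.Perfection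

variable (F₁ : Type) [Field F₁] [NumberField F₁] (K₁ : Type) [Field K₁] [Algebra F₁ K₁] [IsGalois F₁ K₁]
variable (F₂ : Type) [Field F₂] [NumberField F₂] (K₂ : Type) [Field K₂] [Algebra F₂ K₂] [IsGalois F₂ K₂]

/-- **The setting of the proof of Thm. 4.2 HOLDS at THE perfections `C_{K₁/F₁}^pf ⥲ C_{K₂/F₂}^pf`** for
every `Ψ : C_{K₁/F₁} ⥲ C_{K₂/F₂}`: the `C_{K_i/F_i}^pf` are Frobenioids (Prop. 3.2 (iii)) of perfect, isotropic
type with `Φ_i^pf` perf-factorial, and `Ψ^pf`, `(Ψ^pf)⁻¹` preserve (pre-)steps, Frobenius type and degrees,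
pull-backs (Thm. 3.4 (ii)(iii)) — abc-iut-L1's `FrdI.T42.setting_perfection` with every input a theorem of
the tree at `C_{K/F}`. [cite: MochizukiFrdI2008, Thm. 4.2 p.78] -/
theorem setting_arith_perfection (Ψ : arithFrobenioid F₁ K₁ ≌ arithFrobenioid F₂ K₂) :
    haveI := map_isEquivalence (hF₁ := arithFrobenioid_isFrobenioid F₁ K₁)
      (hF₂ := arithFrobenioid_isFrobenioid F₂ K₂) Ψ (PreFrobenioid.isFrobeniusCompatible_arith F₁ K₁ F₂ K₂ Ψ)
    Literature.AlgebraicGeometry.Frobenioids.FrdI.T42.Setting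
      (ops (arithFrobenioid_isFrobenioid F₁ K₁)).toFunctor (ops (arithFrobenioid_isFrobenioid F₂ K₂)).toFunctor
      (map (hF₁ := arithFrobenioid_isFrobenioid F₁ K₁) (hF₂ := arithFrobenioid_isFrobenioid F₂ K₂)
        (PreFrobenioid.isFrobeniusCompatible_arith F₁ K₁ F₂ K₂ Ψ)).asEquivalence := by
  have hF₁ := arithFrobenioid_isFrobenioid F₁ K₁
  have hF₂ := arithFrobenioid_isFrobenioid F₂ K₂
  have hT : Thm42Setting
      (ofFunctor (arithDivisorFunctor F₁ K₁)
        (ModelFrobenioid.toElem (arithDivisorFunctor F₁ K₁) (unitsFunctor F₁ K₁) (divNatTrans F₁ K₁)))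
      (ofFunctor (arithDivisorFunctor F₂ K₂)
        (ModelFrobenioid.toElem (arithDivisorFunctor F₂ K₂) (unitsFunctor F₂ K₂) (divNatTrans F₂ K₂))) :=
    FrdI.T49.thm42Setting_arith F₁ K₁ F₂ K₂
  obtain ⟨hi₁, hi₂, -, -, ⟨N₁, hN₁⟩, ⟨N₂, hN₂⟩⟩ := of_thm42Setting hT
  have hΨ := PreFrobenioid.isFrobeniusCompatible_arith F₁ K₁ F₂ K₂ Ψ
  -- the perfections `C_i^pf` are Frobenioids (Prop. 3.2 (iii))
  have hPf₁ := PreFrobenioid.Perfection.isFrobenioid hF₁ (isFrobeniusIsotropic_of_isOfIsotropicType hF₁ hi₁)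
  have hPf₂ := PreFrobenioid.Perfection.isFrobenioid hF₂ (isFrobeniusIsotropic_of_isOfIsotropicType hF₂ hi₂)
  exact setting_perfection Ψ hF₁ hF₂ hPf₁ hPf₂ hi₁ hi₂ (arith_objectwise_isPerfFactorial F₁ K₁)
    (arith_objectwise_isPerfFactorial F₂ K₂) hT.standard.1.nonDilating hT.standard.2.nonDilating
    (FinSubextCat.isOfFSMType F₁ K₁) (FinSubextCat.isOfFSMType F₂ K₂) hN₁ hN₂ hΨ

/-- **F-2396, INSTANCE (GENUINE, print generality): Thm. 4.2 (i)'s "`Ψ` maps primary steps to or from `A₁`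
to primary steps to or from `A₂`" at THE arithmetic Frobenioids.**  For number fields `F_i ⊆ K_i` with
`K_i/F_i` Galois and EVERY equivalence `Ψ : C_{K₁/F₁} ⥲ C_{K₂/F₂}`, the induced equivalence of perfections
`Ψ^pf` preserves primary steps to or from `A`, and primary composites through `A`, at EVERY object `A` of
`C_{K₁/F₁}^pf` — `FrdI.T42.preservesPrimaryAt` at `setting_arith_perfection`, no hypothesis left.
[cite: MochizukiFrdI2008, Thm. 4.2 (i) p.78] -/
theorem preservesPrimaryAt_arith_perfection (Ψ : arithFrobenioid F₁ K₁ ≌ arithFrobenioid F₂ K₂)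
    (A : PreFrobenioid.Perfection (arithFrobenioid_isFrobenioid F₁ K₁)) :
    haveI := map_isEquivalence (hF₁ := arithFrobenioid_isFrobenioid F₁ K₁)
      (hF₂ := arithFrobenioid_isFrobenioid F₂ K₂) Ψ (PreFrobenioid.isFrobeniusCompatible_arith F₁ K₁ F₂ K₂ Ψ)
    Literature.AlgebraicGeometry.Frobenioids.FrdI.T42.PreservesPrimaryAt
      (ops (arithFrobenioid_isFrobenioid F₁ K₁)).toFunctor (ops (arithFrobenioid_isFrobenioid F₂ K₂)).toFunctor
      (map (hF₁ := arithFrobenioid_isFrobenioid F₁ K₁) (hF₂ := arithFrobenioid_isFrobenioid F₂ K₂)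
        (PreFrobenioid.isFrobeniusCompatible_arith F₁ K₁ F₂ K₂ Ψ)).asEquivalence A :=
  preservesPrimaryAt (setting_arith_perfection F₁ K₁ F₂ K₂ Ψ) A

/-- **F-2396, INSTANCE at a single arithmetic Frobenioid**: the case `Ψ = 𝟭_{C_{K/F}}` of
`preservesPrimaryAt_arith_perfection` (here `Ψ^pf = (𝟭)^pf`, NOT definitionally the identity of the perfection —
a bona fide instance of the `Setting`, unlike `preservesPrimaryAt_refl`), at the object `(A, 1)` of `C_{K/F}^pf`
under every object `A` of `C_{K/F}`. [cite: MochizukiFrdI2008, Thm. 4.2 (i) p.78] -/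
theorem preservesPrimaryAt_arith_perfection_refl (A : arithFrobenioid F₁ K₁) :
    haveI := map_isEquivalence (hF₁ := arithFrobenioid_isFrobenioid F₁ K₁)
      (hF₂ := arithFrobenioid_isFrobenioid F₁ K₁) (CategoryTheory.Equivalence.refl (C := arithFrobenioid F₁ K₁))
      (PreFrobenioid.isFrobeniusCompatible_arith F₁ K₁ F₁ K₁
        (CategoryTheory.Equivalence.refl (C := arithFrobenioid F₁ K₁)))
    Literature.AlgebraicGeometry.Frobenioids.FrdI.T42.PreservesPrimaryAt
      (ops (arithFrobenioid_isFrobenioid F₁ K₁)).toFunctor (ops (arithFrobenioid_isFrobenioid F₁ K₁)).toFunctor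
      (map (hF₁ := arithFrobenioid_isFrobenioid F₁ K₁) (hF₂ := arithFrobenioid_isFrobenioid F₁ K₁)
        (PreFrobenioid.isFrobeniusCompatible_arith F₁ K₁ F₁ K₁
        (CategoryTheory.Equivalence.refl (C := arithFrobenioid F₁ K₁)))).asEquivalence
      ((toPf (arithFrobenioid_isFrobenioid F₁ K₁)).obj A) :=
  preservesPrimaryAt_arith_perfection F₁ K₁ F₁ K₁ _ _

end ArithPerfection

end FrdI.T42

end Literature.AlgebraicGeometry.Frobenioids
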